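import Summits.BirchSwinnertonDyer.BirchSwinnertonDyer.Theorems.SchneiderFreeAdditiveX3GordTwoBranchIMCOfKYBranchArtin
import Summits.BirchSwinnertonDyer.BirchSwinnertonDyer.Theorems.SchneiderFreeAdditiveX3KYReadValueOfCHFrame
import HarnessLib
import HarnessLib.Audit.Tags

/-!
# Route `SchneiderFreeAdditiveX3` (K1 door), crux `GordTwoBranchIMC` (stmt-BirchSwinnertonDyer-19177):
# the (G-ord, `e = 2`) socket at one frame with `KYReadCHValue` REPLACED by Castella–Hsieh's value at
# THEIR frame + Keller–Yin's `μ`-clause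

Cell `bsd-schneider-ideate` (HOME `run/shared/lean/pub/bsd-schneider-ideate/`), seat `door-c3` gen 10.
PARTITION: board row B6 ∩ X3 ∩ sst-twist, r = 1, (G-ord, `e = 2`) half (2 560 of 7 101 pairs) of
`Rank1Residual.partition`; SHRINKS crux r3's record: in door-c3 gen 9's Gross-free socket theorem
`additiveIMCLowerBDPOnTreeLeAt_of_KY_branch_of_valueAt_conj_artin` (file `…OfKYBranchArtin.lean`) the
hypothesis `hval` (= `KYRead.KYReadCHValue` at the datum: an INTEGRAL cofactor at EVERY `μ = 0` frame,
logarithm descended to `W(K)`) is DISCHARGED from the printed-shape inputs by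
`hval_of_CH_frame_value` (`…KYReadValueOfCHFrame.lean`): (a) ONE frame `(e_c = ±1, Ω_K, Ω_p ∈ R₀ˣ, L_c)`
of `(Dt′.f, χ_ε)` at `𝔭′` with Castella–Hsieh's value `L_c(𝟙) = u_c·(log_{ω_{W′}} z)²`, `u_c ∈ R₀`, the
`ℂ_p`-logarithm along `ι′⁻¹` of the genus-twisted conductor-`p` trace `z` (Math. Ann. 370 (2018) Thm.
5.7 / Lemma 5.4 — the typed cite item wi-73260 will supply exactly these binders); (b) Keller–Yin's
clause "`μ(𝓛_ε) = 0`" for that normalisation (`thm351_mu_zero_branch_OPEN`, PREPRINT — a NEW named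
input of the record; gen 9 used it informally); (c) "`ι′⁻¹ ∘ ι_c` induces `𝔭′`" read at the embedding
`ι_c` of the field carrying the Heegner points (`hind`). Everything else as in gen 9's socket:
`hKY`/`hKYb` (PREPRINT), `hCHx` (PUBLISHED), the named facts, the good member, CTL₀. Closes nothing
(BSD not advanced); the next step is the `d_K ≠ −3` socket / crux BY NAME / leaf twins of
`…OfKYBranchArtin.lean` §§2–5 over this theorem, with (a) packaged as a `@[conjecture]` predicate or the
landed wi-73260 fact.
-/

noncomputable section

open scoped Classical ComplexConjugate

open WeierstrassCurve NumberField IsDedekindDomain Field PowerSeries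
  Literature.NumberTheory.EllipticCurves
  Literature.NumberTheory.EllipticCurves.CaiShuTian2014
  Literature.NumberTheory.EllipticCurves.ModularForms
  Literature.NumberTheory.EllipticCurves.GreenbergSelmer
  Literature.NumberTheory.EllipticCurves.Rank1Residual
  Literature.NumberTheory.EllipticCurves.KellerYin2024
  Literature.NumberTheory.GaloisRepresentations
  Literature.NumberTheory.GaloisCohomology
  Literature.NumberTheory.EllipticCurves.FormalGroupChart
  Summit.BirchSwinnertonDyer.Rank1Residual
  Summit.BirchSwinnertonDyer.Rank1Residual.X11b
  Summit.BirchSwinnertonDyer.Rank1Residual.X11b.AcSelmer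
  Summit.BirchSwinnertonDyer.Rank1Residual.X11b.Halves
  Summit.BirchSwinnertonDyer.BirchSwinnertonDyer.Theses.SchneiderFreeAdditiveX3
  Summit.BirchSwinnertonDyer.BirchSwinnertonDyer.Theorems.SchneiderFree.KYRead

set_option linter.dupNamespace false
set_option autoImplicit false

namespace Summit.BirchSwinnertonDyer.BirchSwinnertonDyer.Theorems.SchneiderFree

/-- **The rebased road at one frame — branch currency, Gross-2004-free, with the VALUE HALF supplied by
Castella–Hsieh's value at their own frame** (door-c3 gen 9's
`additiveIMCLowerBDPOnTreeLeAt_of_KY_branch_of_valueAt_conj_artin` with `hval` := gen 10's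
`KYRead.LogDescent.hval_of_CH_frame_value`). New inputs w.r.t. gen 9: `hKYμ`
(`thm351_mu_zero_branch_OPEN`, PREPRINT), `hind` (the frame's prime read at `ι_c`), and the CH frame
`(e_c = ±1, Ω_K^c ≠ 0, Ω_p^c ∈ R₀ˣ, L_c)` with its printed-shape value `hval_c` (cite item wi-73260);
REMOVED: `hval`. CONDITIONAL on the named facts, the preprint claims and the hypotheses; nothing
asserted about BSD. [cite: CastellaHsieh2018, Thm. 5.7 and Lemma 5.4 (arXiv:1505.08165 pp. 17–19) (shape of hval_c)]
[cite: KellerYin2024b, Thm. 3.5.1 (arXiv:2410.23241 p. 20) (preprint; (iii) and the μ-clause)] -/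
theorem additiveIMCLowerBDPOnTreeLeAt_of_CH_frame_value_artin (hmod : hasEntireLFunction_rat)
    (hPar : nonempty_modularParametrizationData)
    (hRat : Literature.NumberTheory.EllipticCurves.phi_heegnerPointOfConductor_mem_ringClassField)
    (hCST : thm11_ringClassChar) (hKY : thm351_imc_isTorsion_mu_zero_charIdeal_eq_OPEN)
    (hKYb : thm351_charIdeal_eq_branch_OPEN) (hKYμ : thm351_mu_zero_branch_OPEN)
    (hCHx : castellaHsieh2018_exists_isBranchBDPLFunction)
    -- the prime, the good partner `W′`, the presentation of the door's curve
    {p : ℕ} [Fact p.Prime] (hp2 : p ≠ 2) (W' : WeierstrassCurve ℚ) [W'.IsElliptic]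
    [W'.IsGloballyMinimal] [NeZero (W'.conductorNorm ℤ)] (hgood : W'.HasGoodReductionAtPrime p)
    (hV' : padicValInt p W'.minimalDiscriminantInt < 6)
    (D : VariableChange ℚ) [(D • W').IsCharNeTwoNF] (C₂ : VariableChange ℚ)
    [(C₂ • (D • W').quadraticTwist ((-1 : ℚ) ^ (p / 2) * p)).IsElliptic]
    [(C₂ • (D • W').quadraticTwist ((-1 : ℚ) ^ (p / 2) * p)).IsGloballyMinimal]
    (hadd : Addv (C₂ • (D • W').quadraticTwist ((-1 : ℚ) ^ (p / 2) * p)) p)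
    -- the socket's field and frame
    {N : ℕ} [NeZero N] (K : Type) [Field K] [NumberField K] [IsGalois ℚ K]
    (hK : IsImaginaryQuadratic K)
    (hHe : SatisfiesHeegnerHypothesis N K) (hodd : Odd (NumberField.discr K))
    (hdK : NumberField.discr K ≠ -3) (hpw : ¬ p ∣ Units.torsionOrder K)
    {κ : ZpExtension K p} (hκ : κ.IsAnticyclotomic) {γ : Field.absoluteGaloisGroup K}
    [Fact (κ.IsTopGenerator γ)]
    {𝔭 : HeightOneSpectrum (𝓞 K)} (h𝔭 : ((p : ℕ) : 𝓞 K) ∈ 𝔭.asIdeal)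
    (he : 𝔭.asIdeal.ramificationIdx (𝓞 ℚ) = 1) (hf : 𝔭.asIdeal.inertiaDeg (𝓞 ℚ) = 1)
    -- the conjugate prime and an embedding datum inducing it
    {𝔭' : HeightOneSpectrum (𝓞 K)} (h𝔭' : ((p : ℕ) : 𝓞 K) ∈ 𝔭'.asIdeal)
    (he' : 𝔭'.asIdeal.ramificationIdx (𝓞 ℚ) = 1) (hf' : 𝔭'.asIdeal.inertiaDeg (𝓞 ℚ) = 1)
    (hne : 𝔭 ≠ 𝔭') {ι' : PadicAlgCl p ≃+* ℂ} (hι' : BranchInducesPrime p ι' 𝔭')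
    -- the route's Heegner datum and the printed facts for `E`
    (hGZ : gross_zagier N (C₂ • (D • W').quadraticTwist ((-1 : ℚ) ^ (p / 2) * p)) K)
    (hKo : kolyvagin N (C₂ • (D • W').quadraticTwist ((-1 : ℚ) ^ (p / 2) * p)) K)
    (Dt : ModularParametrizationData (C₂ • (D • W').quadraticTwist ((-1 : ℚ) ^ (p / 2) * p)) N)
    (H : HeegnerDatum N (NumberField.discr K)) (ιK : K →+* ℂ)
    (P : ((C₂ • (D • W').quadraticTwist ((-1 : ℚ) ^ (p / 2) * p)).baseChange K).toAffine.Point)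
    (hP : WeierstrassCurve.Affine.Point.map ιK.toRatAlgHom P = heegnerPointComplex Dt H)
    (hnt : ¬ IsOfFinAddOrder P)
    -- CTL₀ (control corner)
    {n : ℕ} (hn : XAc.HasCharValuationAt
      ((C₂ • (D • W').quadraticTwist ((-1 : ℚ) ^ (p / 2) * p)).baseChange K) p κ 𝔭 ∅ γ n)
    -- the good member of the isogeny class (Keller–Yin's per-curve hypotheses)
    {W₁ : WeierstrassCurve ℚ} [W₁.IsElliptic] [W₁.IsGloballyMinimal]
    (φ : WeierstrassCurve.Isogeny W₁ (C₂ • (D • W').quadraticTwist ((-1 : ℚ) ^ (p / 2) * p)))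
    {m d : ℕ} (hdeg : φ.degree = p ^ m * d) (hd : ¬ p ∣ d)
    (hN₁ : W₁.conductorNorm ℤ = N) (hcase₁ : W₁.HasGoodOrdinaryReductionOverQuadraticAt p)
    (hred₁ : Red W₁ p)
    (hlat₁ : ∃ Φ : AddSubgroup (geomTorsion W₁ (p : ℤ)),
      IsRationalLine W₁ p Φ ∧ ¬ LineDecompositionTrivialAt W₁ p Φ)
    (htf₁ : ∀ Q : (W₁.baseChange K).toAffine.Point, p • Q = 0 → Q = 0)
    -- the partner's parametrisation datum, the ring class field's embedding, the Manin side condition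
    (ιc : K →+* ℂ) [NumberField (ringClassField K ιc p)]
    (hind : ∀ k : 𝓞 K, k ∈ 𝔭'.asIdeal ↔ ‖ι'.symm (ιc (k : K))‖ < 1)
    (Dt' : ModularParametrizationData W' (W'.conductorNorm ℤ)) (hc0 : Dt.c ≠ 0)
    -- Castella–Hsieh's OWN frame at `𝔭′` and its printed-shape VALUE (cite item wi-73260)
    {e_c : ℂ} {ΩK_c : ℂ} {Ωp_c : (unrIntegers p)ˣ} {L_c : UnrSeries p} (he_c : e_c = 1 ∨ e_c = -1)
    (hΩK_c : ΩK_c ≠ 0)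
    (hL_c : IsBranchBDPLFunction ι' 𝔭' κ γ Dt'.f (genusHeckeCharacter K p) e_c ΩK_c
      ((Ωp_c : unrIntegers p) : ℂ_[p]) L_c)
    (u_c : unrIntegers p)
    (hval_c : ∀ (y : (W'.baseChange (ringClassField K ιc p : Type)).toAffine.Point),
      WeierstrassCurve.Affine.Point.map (ringClassField K ιc p).subtype.toRatAlgHom y =
        heegnerPointComplexOfConductor Dt' (NumberField.discr K) H.β p →
      ∀ (θ : ringClassField K ιc p)
        (_ : θ ^ 2 = algebraMap ℚ (ringClassField K ιc p) ((-1 : ℚ) ^ (p / 2) * p)) (_ : θ ≠ 0)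
        (s : ringClassGal ιc p → ℤˣ),
        (∀ σ : ringClassGal ιc p, σ.1 θ = ((s σ : ℤ) : ringClassField K ιc p) * θ) →
        L_c.HasValueAt 0 (((u_c : unrIntegers p) : ℂ_[p]) *
          (@padicLogPointFiniteExt ℂ_[p] _ NormedField.valuation (W'.baseChange ℂ_[p]) p
            (KYRead.LogDescent.isIntegral_valuation_baseChange W' ℂ_[p])
            (WeierstrassCurve.Affine.Point.map
              ((algebraMap (PadicAlgCl p) ℂ_[p]).comp
                (ι'.symm.toRingHom.comp (ringClassField K ιc p).subtype)).toRatAlgHom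
              (∑ τ : ringClassGal ιc p,
                (s τ : ℤ) • pointGalHom W' (ringClassField K ιc p : Type) τ.1 y))) ^ 2)) :
    AdditiveIMCLowerBDPOnTreeLeAt p κ 𝔭 γ (embAt K p 𝔭 h𝔭 he hf) (padicValNat p Dt.c.natAbs) P := by
  -- Keller–Yin's standing data for the good member at `(v, v̄) := (𝔭′, 𝔭)`, its newform, the twist relation
  have hpN' : ¬ p ∣ W'.conductorNorm ℤ := not_dvd_conductorNorm_of_hasGoodReductionAtPrime W' hgood
  have hS : PotOrdSetting ι' W₁ K 𝔭' 𝔭 κ N :=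
    potOrdSetting_of_socketData hp2 ι' W₁ K 𝔭 𝔭' κ N hN₁ hcase₁ hred₁ hlat₁ htf₁ hK hHe hodd hdK hκ
      h𝔭 he hf hne hι'
  have hf₁ : IsNewformOf W₁ Dt.f := Dt.isNewformOf.of_isIsogenous ⟨φ⟩
  have htw := exists_cofinite_cuspCoeff_eq_legendreSym_mul hp2 W' D C₂ Dt Dt'
  -- every `μ = 0` branch frame at `𝔭′` generates `Char_Λ(𝔛_{W₁})·R₀⟦T⟧` (KY (iii), branch currency)
  have hspan : ∀ (e : ℂ) (ΩK : ℂ) (Ωp : (unrIntegers p)ˣ) (L : UnrSeries p), e ≠ 0 → ΩK ≠ 0 →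
      IsBranchBDPLFunction ι' 𝔭' κ γ Dt'.f (genusHeckeCharacter K p) e ΩK
        ((Ωp : unrIntegers p) : ℂ_[p]) L →
      ¬ C (p : unrIntegers p) ∣ L →
      (AcSelmer.XAc.charIdeal (W₁.baseChange K) p κ 𝔭 ∅ γ).map (PowerSeries.map (toUnr p)) =
        Ideal.span {L} := by
    intro e ΩK Ωp L he0 hΩK hL hμ
    have hΩp : ((Ωp : unrIntegers p) : ℂ_[p]) ≠ 0 := by
      rw [Ne, ZeroMemClass.coe_eq_zero]; exact Ωp.ne_zero
    exact charIdeal_map_eq_span_of_branch_OPEN_of_not_dvd hKYb ι' W₁ K 𝔭' 𝔭 κ γ hf₁ hS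
      Dt'.isNewformOf.1 hpN' htw he0 hΩK hΩp hL hμ (toUnr p) (coe_toUnr p)
  -- `μ(L_c) = 0` (Keller–Yin's clause for Castella–Hsieh's normalisation)
  have hμ_c : ¬ C (p : unrIntegers p) ∣ L_c :=
    hKYμ ι' W₁ K 𝔭' 𝔭 κ γ hf₁ hS Dt'.isNewformOf.1 hpN' htw e_c ΩK_c Ωp_c L_c he_c hΩK_c hL_c
  have he_c0 : e_c ≠ 0 := by rcases he_c with rfl | rfl <;> norm_num
  -- the value half at every `μ = 0` frame
  have hval := KYRead.LogDescent.hval_of_CH_frame_value W' hgood D C₂ hK.1 H h𝔭 he hf h𝔭' he' hf'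
    hne ι' ιc hind Dt' _ hspan he_c0 hΩK_c hL_c hμ_c u_c hval_c
  exact additiveIMCLowerBDPOnTreeLeAt_of_KY_branch_of_valueAt_conj_artin hmod hPar hRat hCST hKY hKYb
    hCHx hp2 W' hgood hV' D C₂ hadd K hK hHe hodd hdK hpw hκ h𝔭 he hf h𝔭' he' hf' hne hι' hGZ hKo Dt H
    ιK P hP hnt hn φ hdeg hd hN₁ hcase₁ hred₁ hlat₁ htf₁ ιc Dt' hc0 hval

end Summit.BirchSwinnertonDyer.BirchSwinnertonDyer.Theorems.SchneiderFree

end
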